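import Summits.QuantumFields.YangMills.Theorems.BalabanUVNodesN15TwoSpacingGluingCurvedKnitReg335Box
import Summits.QuantumFields.YangMills.Theorems.BalabanUVNodesN15CurvedGluingCubeDressedGeneralRightEntries
import HarnessLib

/-!
# THE SANDWICHED RIGHT ENTRIES OF THE CUT FLAT CUBE AT THE COVER, ON THE COLOURED CARRIER — `(M_{χ_□}G(□_k) ⊗ 1)∘∇̂^{±}_μ∘M_{χ_k} = (T^{±}_μ ⊗ 1)∘M_{χ_k}` EXACTLY,
# the entries' plateau `T^{±}∘M_{ψ_k} = T^{±}`, the nested cut-offs around the cut cube (`M_χM_ψ`, `M_χ∇̂^{±}M_ψ`, `M_χ̃M_ψ`), and the partition's transition layers inside `{χ_k = 1}`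
# (dag-n15-c g19, n15-c∕172; N15 = NE2, s1 road (c) — the cover producers of FILES n15-c∕167–169's `hTf`∕`hTb`∕`hTfψ`∕`hTbψ`∕`hlayf`∕`hlayb`∕`hlayν` and of the cut-cube rewrites)

Cell `pub-ymgap`, seat `pub-ymgap-dag-n15-c` (R134 (a); HUMAN RULING D-0062), generation 19.  `bears_on: R4∕N15 · K3⁸ SpineGivenEndpointR13SepCoPHV (stmt-QuantumFields-27366)`.
Filed `--kind proof --supports stmt-QuantumFields-27366 --as helper` — COUNT-NEUTRAL.  Theorems only; 0 `def`, 0 `sorry`.  Imports BY NAME FILE 127 `…TwoSpacingGluingCurvedKnitReg335Box`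
(`blockOf_shift_mem_cubeBlocks`; through it FILES 117∕118 `mem_cubeBlocks_of_mem_inner`, `chiCube_eq_one_of_inner_ne_zero`, `mulOp_chiCube_idem`, the `⊗ 1_ι` dictionary `fgrad_liftEquiv_eq` ∕
`bgrad_liftEquiv_eq` ∕ `mulOp_fst_comp_tensorId` ∕ `tensorId_comp_mulOp_fst` ∕ `tensorId_comp_tensorId` ∕ `tensorId_comp_mulOp_fst_of`, dag-n15-a N-IIn `chiCube_neumannCubeG_comp_sD_mulOp` ∕
`chiCube_neumannCubeG_comp_bgrad_mulOp`, `symbOp_sD_eq`, dag-n15-w4 `chiCube_coverCorner_eq_one_of_near_bbox`, `blockOf_mem_cubeBlocks_of_bcube_cover_ne_zero`) and dag-n15-w3 file 31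
`…CurvedGluingCubeDressedGeneralRightEntries` (`mulOp_comp_fgrad_comp_mulOp_of_margin` ∕ `…bgrad…`).  Nothing in the tree is modified.

WHY (FINDING g19-ii).  FILES n15-c∕167–169 take the flat cube `N_k` through its SANDWICHED RIGHT ENTRIES `N_k∘∇̂^{±}_μ∘M_{χ_k} = T^{±}_{k,μ}∘M_{χ_k}` with `T^{±}` TWO-SIDEDLY localized on the cube's
blocks (FILE 153's `hT…`).  The images cube `G(□_k) = Sym∘G∘M_{χ°}` has its OUTPUT spread over the image cubes, so no such `T` exists for the bare `G(□_k) ⊗ 1`; but every use of `N_k` in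
167–169 is cut on the left by `χ̃_k` or `χ_k`, so the adjoint cover instantiation takes THE CUT CUBE `N_k := M_{ψ_k∘fst}∘(G(□_k) ⊗ 1)` (`ψ_k = χ_{□_k}`), for which dag-n15-a's (a)⁺∕(a)⁻
identities give `T^{+}_μ = χ_□Sym(G∘ρ(sD_μ n))M_{χ_□}`, `T^{−}_μ = −χ_□Sym(G∘ρ(n(s_μ⁻¹ − 1)))M_{χ_□}` — exactly the operators whose rows and two-grid defects dag-n15-a N-IIn∕N-IIg∕N-IIr
prove on the torus family.  The price is one block of margin around the cut box: `m₁ + 1 ≤ m₀`, `(m₀ − m₁) + S₁ + 1 ≤ qw` (at the cover: `3 ≤ (L − 6)L^m`).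

WHAT.  §1 `cutCube_comp_fgrad_comp_mulOp` ∕ `cutCube_comp_bgrad_comp_mulOp` (scalar, any cube `M_ν = 2S`); §2 `chiCube_box_shift` (the box and its one-step fine neighbours in the cube),
★★ `cutCube_fgrad_cover_lift_sandwich` ∕ ★★ `cutCube_bgrad_cover_lift_sandwich` (`hTf`∕`hTb`), `rightEntryF_comp_psi_cover_lift` ∕ `rightEntryB_comp_psi_cover_lift` (`hTfψ`∕`hTbψ`);
§3 `cut_comp_cutCube_cover_lift`, `bump_comp_cutCube_cover_lift`, `cut_fgrad_cutCube_cover_lift` ∕ `cut_bgrad_cutCube_cover_lift`, `cutCube_comp_psi_cover_lift` (the rewrites that carry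
FILE 120's producers over to the cut cube); §4 `coverH_layer_bwd` ∕ `coverH_layer_fwd` ∕ `coverH_layer_shift` (`hlayf`∕`hlayb`∕`hlayν`: the partition's transition layers and its
`e_ν`-translate lie in `{χ_k = 1}`, box `c(2w,k) + [0,6w+1)`); §5 `abs_shift_sub_le_of_fgrad`, `abs_fgrad_fgrad_le_of`, `abs_bgrad_bgrad_shift_le_of` (167's pointwise letters
`hh0`∕`hh2f`∕`hh2b` from `hh1`∕`hh2`); §6 `coverMargin_cut_margin` (the one-block margin at the cover family, `L ≥ 7`, `L^m ≥ 3`).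

HONEST FRAMING ∕ LIMITS.  Finite-stencil bookkeeping on dag-n15-a's model carriers; nothing of [B5]∕[B6]∕[B9] asserted ((2.37) p.229, (2.133) p.247, (3.62)–(3.65) pp.402–403 = SHAPES).
NE2 for non-abelian `G(U)` NOT proved (C-N15-1); N15 booked «discharged AS CONSUMED at the U-blind v7 pin» (№253) — road (c)'s bookkeeping, NO count; one finite 𝕋⁴ at fixed ε — NOT
infinite volume, NOT OS, NOT a mass gap, NOT Clay.  Restate-immune (no Theses import).
-/

noncomputable section

namespace Summit.QuantumFields.YangMills.BalabanUVNodes.N15.Gluing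

open Literature.MathematicalPhysics.QuantumFieldTheory.Balaban1983to89
open Literature.MathematicalPhysics.QuantumFieldTheory.Balaban1983to89.B5Prop11Plancherel (Tor fine unitVec)
open Literature.MathematicalPhysics.QuantumFieldTheory.Balaban1983to89.B6Prop26Gluing (mulOp mulOp_apply)
open Literature.MathematicalPhysics.QuantumFieldTheory.King1986.Torus (blockOf)
open Summit.QuantumFields.YangMills.BalabanUVNodes.N15.BackgroundLayer (fgrad bgrad fgradAdj fgrad_apply bgrad_apply fgradAdj_apply symbOp_sD_eq tensorId_comp_tensorId)
open Summit.QuantumFields.YangMills.BalabanUVNodes.N15.VectorPiece (bshiftEquiv bshiftEquiv_apply bshiftEquiv_symm_apply tensorId)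
open Summit.QuantumFields.YangMills.BalabanUVNodes.N15.MatrixSpecies (liftEquiv liftEquiv_apply liftEquiv_symm_apply)
open Summit.QuantumFields.YangMills.BalabanUVNodes.N15.TwoGrid (symbOp sD sTinv gOp neumannCubeG symOp chiCube cubeBlocks mem_cubeBlocks chiCube_of_not_mem tensorId_mulOp mulOp_fst_comp_tensorId
  tensorId_comp_mulOp_fst chiCube_neumannCubeG_comp_sD_mulOp chiCube_neumannCubeG_comp_bgrad_mulOp)
open Summit.QuantumFields.YangMills.BalabanUVNodes.N15.CurvedSpecies (mulOp_comp_fgrad_comp_mulOp_of_margin mulOp_comp_bgrad_comp_mulOp_of_margin)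

variable {d : ℕ}

/-! ## §1 The cut images cube's sandwiched right entries, scalar carrier -/

section Scalar

variable {M : Fin (d + 1) → ℕ} [∀ μ, NeZero (M μ)] {n : ℕ} [NeZero n] {c : Tor M} {S : ℕ}

/-- ★ **(a)⁺ FOR THIS LINEAGE's FORWARD QUOTIENT**: `(M_{χ_□}G(□))∘∇⁺_μ∘M_g = (χ_□∘Sym∘(G∘ρ(sD_μ n))∘M_{χ_□})∘M_g` for `g` supported on bonds whose block and whose `μ`-predecessor's block
lie in the cube — dag-n15-a N-IIn `chiCube_neumannCubeG_comp_sD_mulOp` read through `ρ(sD_μ n) = fgrad n (bshiftEquiv μ)`. [cite: Balaban1984PropagatorsI, (1.3) p.18, Prop. 1.2 (1.110) p.35] -/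
theorem cutCube_comp_fgrad_comp_mulOp (hM : ∀ ν, M ν = 2 * S) {a : ℝ} (ha : 0 < a) (μ : Fin (d + 1)) {g : Tor (fine n M) × Fin (d + 1) → ℝ}
    (hg : ∀ b, g b ≠ 0 → blockOf n M b.1 ∈ cubeBlocks M c S ∧ blockOf n M (b.1 - unitVec (fine n M) μ) ∈ cubeBlocks M c S) :
    (mulOp (chiCube M n c S) ∘ₗ neumannCubeG M n c S a) ∘ₗ fgrad (n : ℝ) (bshiftEquiv M n μ) ∘ₗ mulOp g =
      (mulOp (chiCube M n c S) ∘ₗ symOp M n c ∘ₗ (gOp M n a ∘ₗ symbOp M n (sD M n μ (n : ℝ))) ∘ₗ mulOp (chiCube M n c S)) ∘ₗ mulOp g := by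
  rw [← symbOp_sD_eq M n μ]
  exact chiCube_neumannCubeG_comp_sD_mulOp hM (Nat.one_le_iff_ne_zero.mpr (NeZero.ne n)) ha μ hg

/-- ★ **(a)⁻ FOR THIS LINEAGE's BACKWARD QUOTIENT**: `(M_{χ_□}G(□))∘∇⁻_μ∘M_g = (−(χ_□∘Sym∘(G∘ρ(n(s_μ⁻¹ − 1)))∘M_{χ_□}))∘M_g` for `g` supported on bonds whose block and whose `μ`-successor's
block lie in the cube — dag-n15-a N-IIn `chiCube_neumannCubeG_comp_bgrad_mulOp`. [cite: Balaban1984PropagatorsI, (1.3) p.18, Prop. 1.2 (1.110) p.35 (entry «G∇*»)] -/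
theorem cutCube_comp_bgrad_comp_mulOp (hM : ∀ ν, M ν = 2 * S) {a : ℝ} (ha : 0 < a) (μ : Fin (d + 1)) {g : Tor (fine n M) × Fin (d + 1) → ℝ}
    (hg : ∀ b, g b ≠ 0 → blockOf n M b.1 ∈ cubeBlocks M c S ∧ blockOf n M (b.1 + unitVec (fine n M) μ) ∈ cubeBlocks M c S) :
    (mulOp (chiCube M n c S) ∘ₗ neumannCubeG M n c S a) ∘ₗ bgrad (n : ℝ) (bshiftEquiv M n μ) ∘ₗ mulOp g =
      (-(mulOp (chiCube M n c S) ∘ₗ symOp M n c ∘ₗ (gOp M n a ∘ₗ symbOp M n ((n : ℝ) • (sTinv M n μ - 1))) ∘ₗ mulOp (chiCube M n c S))) ∘ₗ mulOp g := by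
  rw [chiCube_neumannCubeG_comp_bgrad_mulOp hM (Nat.one_le_iff_ne_zero.mpr (NeZero.ne n)) ha μ hg, LinearMap.neg_comp]

end Scalar

/-! ## §2 At the cover, on the coloured carrier: the box's one-step neighbourhood in the cube; `hTf`, `hTb`, `hTfψ`, `hTbψ` -/

section Cover

variable {M : Fin (d + 1) → ℕ} [∀ μ, NeZero (M μ)] {n w q m₀ m₁ S₁ : ℕ} [NeZero n] (ι : Type) [Fintype ι]

omit [Fintype ι] in
/-- **THE BOX AND ITS ONE-STEP FINE NEIGHBOURS LIE IN THE CUBE**: `χ_{c(m₁,k)+[0,S₁)}(x) ≠ 0 ⟹ χ_□(x) = χ_□(x + e′_μ) = χ_□(x − e′_μ) = 1` for the cube `□ = c(m₀,k) + [0,qw)`, margin `m₁ + 1 ≤ m₀`,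
`(m₀ − m₁) + S₁ + 1 ≤ qw` (FILE 127 `blockOf_shift_mem_cubeBlocks`). [cite: Balaban1985BackgroundPropagators, (3.62)–(3.65) pp.402–403 (nested cut-offs: shape)] -/
theorem chiCube_box_shift (hM : ∀ ν, M ν = 2 * q * w) (hm : m₁ + 1 ≤ m₀) (hfit : (m₀ - m₁) + S₁ + 1 ≤ q * w) (hS₀ : q * w ≤ 2 * q * w) {k : Fin (d + 1) → ZMod (2 * q)}
    (μ : Fin (d + 1)) {x : Tor (fine n M) × Fin (d + 1)} (hx : chiCube M n (coverCorner M w q m₁ k) S₁ x ≠ 0) :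
    chiCube M n (coverCorner M w q m₀ k) (q * w) x = 1 ∧ chiCube M n (coverCorner M w q m₀ k) (q * w) (bshiftEquiv M n μ x) = 1 ∧
      chiCube M n (coverCorner M w q m₀ k) (q * w) ((bshiftEquiv M n μ).symm x) = 1 := by
  have hb : blockOf n M x.1 ∈ cubeBlocks M (coverCorner M w q m₁ k) S₁ := by by_contra h; exact hx (chiCube_of_not_mem h)
  obtain ⟨h0, h1, h2⟩ := blockOf_shift_mem_cubeBlocks (n := n) hM hm hfit hS₀ hb μ
  refine ⟨?_, ?_, ?_⟩
  · unfold chiCube; rw [if_pos h0]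
  · unfold chiCube; rw [bshiftEquiv_apply, if_pos h1]
  · unfold chiCube; rw [bshiftEquiv_symm_apply, if_pos h2]

omit [Fintype ι] in
/-- ★★ **`hTf` AT THE COVER**: `(M_{ψ_k∘fst}∘(G(□_k) ⊗ 1))∘∇̂⁺_μ∘M_{χ_k∘fst} = (T⁺_{k,μ} ⊗ 1)∘M_{χ_k∘fst}`, `T⁺_{k,μ} = χ_□Sym(G∘ρ(sD_μ n))M_{χ_□}`, weight `c = n`, for the cut cube of the cover and the
box cut `χ_k = χ_{c(m₁,k)+[0,S₁)}` one block inside the cube. [cite: Balaban1985BackgroundPropagators, (3.42) p.397 (entry 2: shape); Balaban1984PropagatorsI, Prop. 1.2 (1.110) p.35] -/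
theorem cutCube_fgrad_cover_lift_sandwich (hM : ∀ ν, M ν = 2 * q * w) (hm : m₁ + 1 ≤ m₀) (hfit : (m₀ - m₁) + S₁ + 1 ≤ q * w) (hS₀ : q * w ≤ 2 * q * w) {a : ℝ} (ha : 0 < a)
    {c : ℝ} (hc : c = (n : ℝ)) (μ : Fin (d + 1)) (k : Fin (d + 1) → ZMod (2 * q)) :
    (mulOp (fun p : (Tor (fine n M) × Fin (d + 1)) × ι => chiCube M n (coverCorner M w q m₀ k) (q * w) p.1) ∘ₗ tensorId ι (neumannCubeG M n (coverCorner M w q m₀ k) (q * w) a)) ∘ₗ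
        fgrad c (liftEquiv (bshiftEquiv M n μ) ι) ∘ₗ mulOp (fun p : (Tor (fine n M) × Fin (d + 1)) × ι => chiCube M n (coverCorner M w q m₁ k) S₁ p.1) =
      tensorId ι (mulOp (chiCube M n (coverCorner M w q m₀ k) (q * w)) ∘ₗ symOp M n (coverCorner M w q m₀ k) ∘ₗ
          (gOp M n a ∘ₗ symbOp M n (sD M n μ (n : ℝ))) ∘ₗ mulOp (chiCube M n (coverCorner M w q m₀ k) (q * w))) ∘ₗ
        mulOp (fun p : (Tor (fine n M) × Fin (d + 1)) × ι => chiCube M n (coverCorner M w q m₁ k) S₁ p.1) := by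
  subst hc
  have hM' : ∀ ν, M ν = 2 * (q * w) := fun ν => by rw [hM ν, mul_assoc]
  rw [fgrad_liftEquiv_eq, mulOp_fst_comp_tensorId, tensorId_comp_mulOp_fst, tensorId_comp_tensorId,
    cutCube_comp_fgrad_comp_mulOp (c := coverCorner M w q m₀ k) hM' ha μ fun b hb => ?_, ← tensorId_comp_mulOp_fst]
  have h := chiCube_box_shift (n := n) hM hm hfit hS₀ μ hb
  refine ⟨?_, ?_⟩
  · by_contra hne; rw [chiCube_of_not_mem hne] at h; exact zero_ne_one h.1
  · by_contra hne
    have h2 := h.2.2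
    unfold chiCube at h2; rw [bshiftEquiv_symm_apply, if_neg hne] at h2; exact zero_ne_one h2

omit [Fintype ι] in
/-- ★★ **`hTb` AT THE COVER**: `(M_{ψ_k∘fst}∘(G(□_k) ⊗ 1))∘∇̂⁻_μ∘M_{χ_k∘fst} = (T⁻_{k,μ} ⊗ 1)∘M_{χ_k∘fst}`, `T⁻_{k,μ} = −χ_□Sym(G∘ρ(n(s_μ⁻¹ − 1)))M_{χ_□}`, weight `c = n`.
[cite: Balaban1985BackgroundPropagators, (3.42) p.397 (entry 2: shape); Balaban1984PropagatorsI, Prop. 1.2 (1.110) p.35 (entry «G∇*»)] -/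
theorem cutCube_bgrad_cover_lift_sandwich (hM : ∀ ν, M ν = 2 * q * w) (hm : m₁ + 1 ≤ m₀) (hfit : (m₀ - m₁) + S₁ + 1 ≤ q * w) (hS₀ : q * w ≤ 2 * q * w) {a : ℝ} (ha : 0 < a)
    {c : ℝ} (hc : c = (n : ℝ)) (μ : Fin (d + 1)) (k : Fin (d + 1) → ZMod (2 * q)) :
    (mulOp (fun p : (Tor (fine n M) × Fin (d + 1)) × ι => chiCube M n (coverCorner M w q m₀ k) (q * w) p.1) ∘ₗ tensorId ι (neumannCubeG M n (coverCorner M w q m₀ k) (q * w) a)) ∘ₗ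
        bgrad c (liftEquiv (bshiftEquiv M n μ) ι) ∘ₗ mulOp (fun p : (Tor (fine n M) × Fin (d + 1)) × ι => chiCube M n (coverCorner M w q m₁ k) S₁ p.1) =
      tensorId ι (-(mulOp (chiCube M n (coverCorner M w q m₀ k) (q * w)) ∘ₗ symOp M n (coverCorner M w q m₀ k) ∘ₗ
          (gOp M n a ∘ₗ symbOp M n ((n : ℝ) • (sTinv M n μ - 1))) ∘ₗ mulOp (chiCube M n (coverCorner M w q m₀ k) (q * w)))) ∘ₗ
        mulOp (fun p : (Tor (fine n M) × Fin (d + 1)) × ι => chiCube M n (coverCorner M w q m₁ k) S₁ p.1) := by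
  subst hc
  have hM' : ∀ ν, M ν = 2 * (q * w) := fun ν => by rw [hM ν, mul_assoc]
  rw [bgrad_liftEquiv_eq, mulOp_fst_comp_tensorId, tensorId_comp_mulOp_fst, tensorId_comp_tensorId,
    cutCube_comp_bgrad_comp_mulOp (c := coverCorner M w q m₀ k) hM' ha μ fun b hb => ?_, ← tensorId_comp_mulOp_fst]
  have h := chiCube_box_shift (n := n) hM hm hfit hS₀ μ hb
  refine ⟨?_, ?_⟩
  · by_contra hne; rw [chiCube_of_not_mem hne] at h; exact zero_ne_one h.1
  · by_contra hne
    have h2 := h.2.1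
    unfold chiCube at h2; rw [bshiftEquiv_apply, if_neg hne] at h2; exact zero_ne_one h2

omit [Fintype ι] in
/-- `hTfψ` at the cover: `(T⁺ ⊗ 1)∘M_{ψ∘fst} = T⁺ ⊗ 1` — the entry ends with the cube's source cut (`mulOp_chiCube_idem`). [cite: Balaban1984PropagatorsII, (2.37) p.229 (shape)] -/
theorem rightEntryF_comp_psi_cover_lift {a : ℝ} (μ : Fin (d + 1)) (k : Fin (d + 1) → ZMod (2 * q)) :
    tensorId ι (mulOp (chiCube M n (coverCorner M w q m₀ k) (q * w)) ∘ₗ symOp M n (coverCorner M w q m₀ k) ∘ₗ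
          (gOp M n a ∘ₗ symbOp M n (sD M n μ (n : ℝ))) ∘ₗ mulOp (chiCube M n (coverCorner M w q m₀ k) (q * w))) ∘ₗ
        mulOp (fun p : (Tor (fine n M) × Fin (d + 1)) × ι => chiCube M n (coverCorner M w q m₀ k) (q * w) p.1) =
      tensorId ι (mulOp (chiCube M n (coverCorner M w q m₀ k) (q * w)) ∘ₗ symOp M n (coverCorner M w q m₀ k) ∘ₗ
          (gOp M n a ∘ₗ symbOp M n (sD M n μ (n : ℝ))) ∘ₗ mulOp (chiCube M n (coverCorner M w q m₀ k) (q * w))) :=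
  tensorId_comp_mulOp_fst_of ι (by rw [LinearMap.comp_assoc, LinearMap.comp_assoc, LinearMap.comp_assoc, mulOp_chiCube_idem])

omit [Fintype ι] in
/-- `hTbψ` at the cover: `(T⁻ ⊗ 1)∘M_{ψ∘fst} = T⁻ ⊗ 1`. [cite: Balaban1984PropagatorsII, (2.37) p.229 (shape)] -/
theorem rightEntryB_comp_psi_cover_lift {a : ℝ} (μ : Fin (d + 1)) (k : Fin (d + 1) → ZMod (2 * q)) :
    tensorId ι (-(mulOp (chiCube M n (coverCorner M w q m₀ k) (q * w)) ∘ₗ symOp M n (coverCorner M w q m₀ k) ∘ₗ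
          (gOp M n a ∘ₗ symbOp M n ((n : ℝ) • (sTinv M n μ - 1))) ∘ₗ mulOp (chiCube M n (coverCorner M w q m₀ k) (q * w)))) ∘ₗ
        mulOp (fun p : (Tor (fine n M) × Fin (d + 1)) × ι => chiCube M n (coverCorner M w q m₀ k) (q * w) p.1) =
      tensorId ι (-(mulOp (chiCube M n (coverCorner M w q m₀ k) (q * w)) ∘ₗ symOp M n (coverCorner M w q m₀ k) ∘ₗ
          (gOp M n a ∘ₗ symbOp M n ((n : ℝ) • (sTinv M n μ - 1))) ∘ₗ mulOp (chiCube M n (coverCorner M w q m₀ k) (q * w)))) :=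
  tensorId_comp_mulOp_fst_of ι (by rw [LinearMap.neg_comp, LinearMap.comp_assoc, LinearMap.comp_assoc, LinearMap.comp_assoc, mulOp_chiCube_idem])

/-! ## §3 The nested cut-offs around the cut cube (the rewrites carrying FILE 120's producers over to `N_k := M_{ψ_k∘fst}∘(G(□_k) ⊗ 1)`) -/

omit [Fintype ι] in
/-- `M_{χ∘fst}∘(M_{ψ∘fst}∘T) = M_{χ∘fst}∘T` for the box cut `χ` inside the cube's cut `ψ` (`m₁ ≤ m₀`, `(m₀ − m₁) + S₁ ≤ qw`). [cite: Balaban1985BackgroundPropagators, (3.62)–(3.65) pp.402–403 (shape)] -/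
theorem cut_comp_cutCube_cover_lift (hM : ∀ ν, M ν = 2 * q * w) (hm : m₁ ≤ m₀) (hfit : (m₀ - m₁) + S₁ ≤ q * w) (hS₀ : q * w ≤ 2 * q * w) (k : Fin (d + 1) → ZMod (2 * q))
    (T : ((Tor (fine n M) × Fin (d + 1)) × ι → ℝ) →ₗ[ℝ] ((Tor (fine n M) × Fin (d + 1)) × ι → ℝ)) :
    mulOp (fun p : (Tor (fine n M) × Fin (d + 1)) × ι => chiCube M n (coverCorner M w q m₁ k) S₁ p.1) ∘ₗ
        (mulOp (fun p : (Tor (fine n M) × Fin (d + 1)) × ι => chiCube M n (coverCorner M w q m₀ k) (q * w) p.1) ∘ₗ T) =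
      mulOp (fun p : (Tor (fine n M) × Fin (d + 1)) × ι => chiCube M n (coverCorner M w q m₁ k) S₁ p.1) ∘ₗ T := by
  rw [← LinearMap.comp_assoc, mulOp_comp_mulOp_of_support fun p hp => chiCube_eq_one_of_inner_ne_zero hM hm hfit hS₀ hp]

omit [Fintype ι] in
/-- `M_{χ̃∘fst}∘(M_{ψ∘fst}∘T) = M_{χ̃∘fst}∘T` for the radius-2 bump inside the cube (`2w ≤ m₀`, `m₀ + 4w + 1 ≤ qw`). [cite: Balaban1985BackgroundPropagators, (3.62)–(3.65) pp.402–403 (shape)] -/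
theorem bump_comp_cutCube_cover_lift (hM : ∀ ν, M ν = 2 * q * w) (hw : 0 < w) (hlo : 2 * w ≤ m₀) (hhi : m₀ + 4 * w + 1 ≤ q * w) (k : Fin (d + 1) → ZMod (2 * q))
    (T : ((Tor (fine n M) × Fin (d + 1)) × ι → ℝ) →ₗ[ℝ] ((Tor (fine n M) × Fin (d + 1)) × ι → ℝ)) :
    mulOp (fun p : (Tor (fine n M) × Fin (d + 1)) × ι => bcube (2 * q) (coverXi M n w) 2 k p.1) ∘ₗ
        (mulOp (fun p : (Tor (fine n M) × Fin (d + 1)) × ι => chiCube M n (coverCorner M w q m₀ k) (q * w) p.1) ∘ₗ T) =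
      mulOp (fun p : (Tor (fine n M) × Fin (d + 1)) × ι => bcube (2 * q) (coverXi M n w) 2 k p.1) ∘ₗ T := by
  have hS : q * w ≤ 2 * q * w := by rw [mul_assoc]; omega
  have hhi' : (m₀ : ℝ) + w + (2 + 1) * w + 1 ≤ (q * w : ℕ) := by
    have : ((m₀ + 4 * w + 1 : ℕ) : ℝ) ≤ ((q * w : ℕ) : ℝ) := by exact_mod_cast hhi
    push_cast at this ⊢; linarith
  rw [← LinearMap.comp_assoc, mulOp_comp_mulOp_of_support fun p hp => ?_]
  have hmem := blockOf_mem_cubeBlocks_of_bcube_cover_ne_zero 2 hM hw (by exact_mod_cast hlo) hhi' hS hp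
  unfold chiCube; rw [if_pos hmem]

omit [Fintype ι] in
/-- `M_{χ∘fst}∘(∇̂⁺_μ∘(M_{ψ∘fst}∘T)) = M_{χ∘fst}∘(∇̂⁺_μ∘T)` — the forward quotient at `x` reads `x` and `x + e′_μ`, both in the cube when `x` is in the box (`m₁ + 1 ≤ m₀`, `(m₀ − m₁) + S₁ + 1 ≤ qw`).
[cite: Balaban1984PropagatorsII, (2.133) p.247 (the enlarged cube: shape)] -/
theorem cut_fgrad_cutCube_cover_lift (hM : ∀ ν, M ν = 2 * q * w) (hm : m₁ + 1 ≤ m₀) (hfit : (m₀ - m₁) + S₁ + 1 ≤ q * w) (hS₀ : q * w ≤ 2 * q * w) (cc : ℝ) (μ : Fin (d + 1))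
    (k : Fin (d + 1) → ZMod (2 * q)) (T : ((Tor (fine n M) × Fin (d + 1)) × ι → ℝ) →ₗ[ℝ] ((Tor (fine n M) × Fin (d + 1)) × ι → ℝ)) :
    mulOp (fun p : (Tor (fine n M) × Fin (d + 1)) × ι => chiCube M n (coverCorner M w q m₁ k) S₁ p.1) ∘ₗ (fgrad cc (liftEquiv (bshiftEquiv M n μ) ι) ∘ₗ
        (mulOp (fun p : (Tor (fine n M) × Fin (d + 1)) × ι => chiCube M n (coverCorner M w q m₀ k) (q * w) p.1) ∘ₗ T)) =
      mulOp (fun p : (Tor (fine n M) × Fin (d + 1)) × ι => chiCube M n (coverCorner M w q m₁ k) S₁ p.1) ∘ₗ (fgrad cc (liftEquiv (bshiftEquiv M n μ) ι) ∘ₗ T) := by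
  have h := mulOp_comp_fgrad_comp_mulOp_of_margin (ι := ι) cc (bshiftEquiv M n μ) (ψX := chiCube M n (coverCorner M w q m₁ k) S₁)
    (ψ₂X := chiCube M n (coverCorner M w q m₀ k) (q * w)) (fun x hx => ⟨(chiCube_box_shift (n := n) hM hm hfit hS₀ μ hx).1, (chiCube_box_shift (n := n) hM hm hfit hS₀ μ hx).2.1⟩)
  rw [← LinearMap.comp_assoc] at h
  simp only [← LinearMap.comp_assoc]
  rw [h]

omit [Fintype ι] in
/-- `M_{χ∘fst}∘(∇̂⁻_μ∘(M_{ψ∘fst}∘T)) = M_{χ∘fst}∘(∇̂⁻_μ∘T)` — the backward quotient at `x` reads `x` and `x − e′_μ`. [cite: Balaban1984PropagatorsII, (2.133) p.247 (shape)] -/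
theorem cut_bgrad_cutCube_cover_lift (hM : ∀ ν, M ν = 2 * q * w) (hm : m₁ + 1 ≤ m₀) (hfit : (m₀ - m₁) + S₁ + 1 ≤ q * w) (hS₀ : q * w ≤ 2 * q * w) (cc : ℝ) (μ : Fin (d + 1))
    (k : Fin (d + 1) → ZMod (2 * q)) (T : ((Tor (fine n M) × Fin (d + 1)) × ι → ℝ) →ₗ[ℝ] ((Tor (fine n M) × Fin (d + 1)) × ι → ℝ)) :
    mulOp (fun p : (Tor (fine n M) × Fin (d + 1)) × ι => chiCube M n (coverCorner M w q m₁ k) S₁ p.1) ∘ₗ (bgrad cc (liftEquiv (bshiftEquiv M n μ) ι) ∘ₗ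
        (mulOp (fun p : (Tor (fine n M) × Fin (d + 1)) × ι => chiCube M n (coverCorner M w q m₀ k) (q * w) p.1) ∘ₗ T)) =
      mulOp (fun p : (Tor (fine n M) × Fin (d + 1)) × ι => chiCube M n (coverCorner M w q m₁ k) S₁ p.1) ∘ₗ (bgrad cc (liftEquiv (bshiftEquiv M n μ) ι) ∘ₗ T) := by
  have h := mulOp_comp_bgrad_comp_mulOp_of_margin (ι := ι) cc (bshiftEquiv M n μ) (ψX := chiCube M n (coverCorner M w q m₁ k) S₁)
    (ψ₂X := chiCube M n (coverCorner M w q m₀ k) (q * w)) (fun x hx => ⟨(chiCube_box_shift (n := n) hM hm hfit hS₀ μ hx).1, (chiCube_box_shift (n := n) hM hm hfit hS₀ μ hx).2.2⟩)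
  rw [← LinearMap.comp_assoc] at h
  simp only [← LinearMap.comp_assoc]
  rw [h]

omit [Fintype ι] in
/-- `hNψ` for the cut cube: `(M_{ψ∘fst}∘(G(□) ⊗ 1))∘M_{ψ∘fst} = M_{ψ∘fst}∘(G(□) ⊗ 1)` (FILE 118 `cube_comp_psi_cover_lift`). [cite: Balaban1984PropagatorsII, (2.37) p.229] -/
theorem cutCube_comp_psi_cover_lift (hM : ∀ ν, M ν = 2 * q * w) {a : ℝ} (ha : 0 < a) (k : Fin (d + 1) → ZMod (2 * q)) :
    (mulOp (fun p : (Tor (fine n M) × Fin (d + 1)) × ι => chiCube M n (coverCorner M w q m₀ k) (q * w) p.1) ∘ₗ tensorId ι (neumannCubeG M n (coverCorner M w q m₀ k) (q * w) a)) ∘ₗ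
        mulOp (fun p : (Tor (fine n M) × Fin (d + 1)) × ι => chiCube M n (coverCorner M w q m₀ k) (q * w) p.1) =
      mulOp (fun p : (Tor (fine n M) × Fin (d + 1)) × ι => chiCube M n (coverCorner M w q m₀ k) (q * w) p.1) ∘ₗ tensorId ι (neumannCubeG M n (coverCorner M w q m₀ k) (q * w) a) := by
  rw [LinearMap.comp_assoc, cube_comp_psi_cover_lift ι hM ha k]

/-! ## §4 The partition's transition layers and its `e_ν`-translate lie in `{χ_k = 1}` (`hlayf`, `hlayb`, `hlayν`) -/

omit [Fintype ι] in
/-- **THE PARTITION, SHIFTED ONE FINE STEP, LIVES WHERE THE BOX CUT IS `1`**: `h_k(x₀) ≠ 0` with `x₀ ∈ {x, x + e′_μ, x − e′_μ}` ⟹ `χ_k(x) = 1` for the box `c(2w,k) + [0,6w+1)` (`6w + 1 ≤ 2qw`) —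
dag-n15-w4 `chiCube_coverCorner_eq_one_of_near_bbox` at radius `R = 0`… read: the open `1`-box of the partition's support sits `2w ≥ 0·w` above the box's corner and `3w + 1 ≤ 6w + 1`
below its top. [cite: Balaban1984PropagatorsII, (2.36)–(2.37) p.229 (supp h ⊂ □: shape); Balaban1985BackgroundPropagators, (3.62)–(3.65) pp.402–403] -/
theorem chiCube_box_eq_one_of_coverH_ne_zero (hM : ∀ ν, M ν = 2 * q * w) (hw : 0 < w) (hS6 : 6 * w + 1 ≤ 2 * q * w) (μ : Fin (d + 1)) (k : Fin (d + 1) → ZMod (2 * q))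
    {x x₀ : Tor (fine n M) × Fin (d + 1)} (hx₀ : x₀ = x ∨ x₀ = bshiftEquiv M n μ x ∨ x₀ = (bshiftEquiv M n μ).symm x) (hne : hcube (2 * q) (coverXi M n w) k x₀ ≠ 0) :
    chiCube M n (coverCorner M w q (2 * w) k) (6 * w + 1) x = 1 :=
  chiCube_coverCorner_eq_one_of_near_bbox 0 hM hw (by simp) (by push_cast; linarith) hS6 μ k x
    ⟨x₀, hx₀, fun ν => (abs_cenRep_lt_one_of_hcube_ne_zero (2 * q) (coverXi M n w) hne ν).trans_eq (by norm_num)⟩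

omit [Fintype ι] in
/-- `hlayf` at the cover: `h_k(x) ≠ h_k(x − e′_μ) ⟹ χ_k(x) = 1`. [cite: Balaban1984PropagatorsII, (2.36)–(2.37) p.229 (shape)] -/
theorem coverH_layer_bwd (hM : ∀ ν, M ν = 2 * q * w) (hw : 0 < w) (hS6 : 6 * w + 1 ≤ 2 * q * w) (k : Fin (d + 1) → ZMod (2 * q)) (μ : Fin (d + 1)) (x : Tor (fine n M) × Fin (d + 1))
    (h : hcube (2 * q) (coverXi M n w) k x ≠ hcube (2 * q) (coverXi M n w) k ((bshiftEquiv M n μ).symm x)) : chiCube M n (coverCorner M w q (2 * w) k) (6 * w + 1) x = 1 := by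
  by_cases h0 : hcube (2 * q) (coverXi M n w) k x = 0
  · rw [h0] at h; exact chiCube_box_eq_one_of_coverH_ne_zero hM hw hS6 μ k (Or.inr (Or.inr rfl)) (Ne.symm h)
  · exact chiCube_box_eq_one_of_coverH_ne_zero hM hw hS6 μ k (Or.inl rfl) h0

omit [Fintype ι] in
/-- `hlayb` at the cover: `h_k(x + e′_μ) ≠ h_k(x) ⟹ χ_k(x) = 1`. [cite: Balaban1984PropagatorsII, (2.36)–(2.37) p.229 (shape)] -/
theorem coverH_layer_fwd (hM : ∀ ν, M ν = 2 * q * w) (hw : 0 < w) (hS6 : 6 * w + 1 ≤ 2 * q * w) (k : Fin (d + 1) → ZMod (2 * q)) (μ : Fin (d + 1)) (x : Tor (fine n M) × Fin (d + 1))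
    (h : hcube (2 * q) (coverXi M n w) k (bshiftEquiv M n μ x) ≠ hcube (2 * q) (coverXi M n w) k x) : chiCube M n (coverCorner M w q (2 * w) k) (6 * w + 1) x = 1 := by
  by_cases h0 : hcube (2 * q) (coverXi M n w) k x = 0
  · rw [h0] at h; exact chiCube_box_eq_one_of_coverH_ne_zero hM hw hS6 μ k (Or.inr (Or.inl rfl)) h
  · exact chiCube_box_eq_one_of_coverH_ne_zero hM hw hS6 μ k (Or.inl rfl) h0

omit [Fintype ι] in
/-- `hlayν` at the cover: `h_k(x + e′_ν) ≠ 0 ⟹ χ_k(x) = 1`. [cite: Balaban1984PropagatorsII, (2.36)–(2.37) p.229 (shape)] -/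
theorem coverH_layer_shift (hM : ∀ ν, M ν = 2 * q * w) (hw : 0 < w) (hS6 : 6 * w + 1 ≤ 2 * q * w) (k : Fin (d + 1) → ZMod (2 * q)) (ν : Fin (d + 1)) (x : Tor (fine n M) × Fin (d + 1))
    (h : hcube (2 * q) (coverXi M n w) k (bshiftEquiv M n ν x) ≠ 0) : chiCube M n (coverCorner M w q (2 * w) k) (6 * w + 1) x = 1 :=
  chiCube_box_eq_one_of_coverH_ne_zero hM hw hS6 ν k (Or.inr (Or.inl rfl)) h

end Cover

/-! ## §5 Pointwise letters of the partition for FILE 167's binders: one-step oscillation from the first quotient, the pure second quotients from the mixed one -/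

section Quotients

variable {X : Type} (cc : ℝ) (e : X ≃ X) {h : X → ℝ} {c : ℝ}

/-- `|h(ex) − h(x)| ≤ c` from `|∇⁺_e h| ≤ c` at a weight `cc ≥ 1` (167's `hh0` from `hh1`). [cite: Balaban1984PropagatorsII, (2.36) p.229 («|∂h_□| ≤ O(1)M⁻¹»: shape)] -/
theorem abs_shift_sub_le_of_fgrad (hcc : 1 ≤ cc) (H : ∀ x, |fgrad cc e h x| ≤ c) (x : X) : |h (e x) - h x| ≤ c := by
  have h1 := H x
  rw [fgrad_apply, abs_mul, abs_of_pos (by linarith)] at h1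
  have h0 : 0 ≤ |h (e x) - h x| := abs_nonneg _
  nlinarith

/-- `|∇⁺_e∇⁺_e h(x)| = |∇*_e∇⁺_e h(ex)|` — so the mixed second-quotient letter bounds the pure forward one (167's `hh2f` from `hh2`). [cite: Balaban1984PropagatorsII, (2.36) p.229 (shape)] -/
theorem abs_fgrad_fgrad_le_of (H : ∀ x, |fgradAdj cc e (fgrad cc e h) x| ≤ c) (x : X) : |fgrad cc e (fgrad cc e h) x| ≤ c := by
  have e1 : fgrad cc e (fgrad cc e h) x = -(fgradAdj cc e (fgrad cc e h) (e x)) := by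
    simp only [fgradAdj_apply, fgrad_apply, Equiv.symm_apply_apply]; ring
  rw [e1, abs_neg]; exact H (e x)

/-- `|∇⁻_e((∇⁻_e h)∘e)(x)| = |∇*_e∇⁺_e h(x)|` (167's `hh2b` from `hh2`). [cite: Balaban1984PropagatorsII, (2.36) p.229 (shape)] -/
theorem abs_bgrad_bgrad_shift_le_of (H : ∀ x, |fgradAdj cc e (fgrad cc e h) x| ≤ c) (x : X) : |bgrad cc e (bgrad cc e h ∘ ⇑e) x| ≤ c := by
  have e1 : bgrad cc e (bgrad cc e h ∘ ⇑e) x = -(fgradAdj cc e (fgrad cc e h) x) := by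
    simp only [bgrad_apply, fgradAdj_apply, fgrad_apply, Function.comp_apply, Equiv.symm_apply_apply, Equiv.apply_symm_apply]; ring
  rw [e1, abs_neg]; exact H x

end Quotients

/-! ## §6 The cut cube's margin at the cover family's window (`m₀ = coverMargin L m`, box `c(2w,k) + [0,6w+1)`, `w = L^m ≥ 3`, `L ≥ 7`) -/

section Margin

variable {L : ℕ}

/-- `2w + 1 ≤ m₀` and `(m₀ − 2w) + (6w + 1) + 1 ≤ Lw` — the one-block margin §2∕§3 ask for, at the cover family (`L ≥ 7`, `w = L^m ≥ 3`, so `(L − 6)w ≥ 3`). [folklore] -/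
theorem coverMargin_cut_margin (hL7 : 7 ≤ L) {m : ℕ} (hw : 3 ≤ L ^ m) :
    2 * L ^ m + 1 ≤ coverMargin L m ∧ (coverMargin L m - 2 * L ^ m) + (6 * L ^ m + 1) + 1 ≤ L * L ^ m := by
  unfold coverMargin
  have h7 : 7 * L ^ m ≤ L * L ^ m := Nat.mul_le_mul_right _ hL7
  have hsub : (L - 2) * L ^ m = L * L ^ m - 2 * L ^ m := Nat.sub_mul L 2 (L ^ m)
  rw [hsub]
  omega

end Margin

end Summit.QuantumFields.YangMills.BalabanUVNodes.N15.Gluing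

end
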